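import Mathlib.Combinatorics.SetFamily.FourFunctions
import Mathlib.Tactic
import HarnessLib
import HarnessLib.Audit.Tags
import Summits.CriticalPhenomena.PercolationContinuityZ3.Theorems.PercNearOneGluingNoHeavyLowerTailSahiColouredDaykinMJ

/-!
# `NoHeavyLowerTail` (crux stmt-CriticalPhenomena-4575), master-family line P1 (gen 31): conjecture MJ is SHARP — a kernel-checked tight instance

Support file (seat `prim-masterthm-p1`, gen 31; `--supports stmt-CriticalPhenomena-4575`).  No definitions, no `sorry`, standard axioms.
The block configuration on `2^6` with blocks `B₀ = {1,2}`, `B₁ = {4,5}`, `B₂ = {0,3}` and petals the singletons of the next block,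
`P = {124, 125 | 045, 345 | 013, 023}`, is crossing, has two members of each colour, and its cross-colour meets together with its complemented
cross-colour joins are exactly the six singletons: `#P = 6 = #(crossColMeets P c ∪ crossColCoJoins F P c)`.  So the inequality of
`SahiColouredDaykin.CrossMeetJoin` cannot be improved by a constant; the exhaustive census of `2^6` (memo
`run/shared/lean/prim/prim-masterthm/FROM-prim-masterthm-p1-g31-RECONCILIATION-AND-MJ.md` §2) shows these block configurations are the ONLY tight ones there. [this work]
-/

namespace Summit.CriticalPhenomena.PercolationContinuityZ3.Theorems.SahiColouredDaykin

open Finset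

/-- The six members of the tight block configuration on `Fin 6`. [this work] -/
private def mjSharpP : Finset (Finset (Fin 6)) :=
  { {1, 2, 4}, {1, 2, 5}, {0, 4, 5}, {3, 4, 5}, {0, 1, 3}, {0, 2, 3} }

/-- Its colouring: `B₀ ∪ {p}` ↦ 0, `B₁ ∪ {p}` ↦ 1, the rest ↦ 2. [this work] -/
private def mjSharpCol (S : Finset (Fin 6)) : Fin 3 :=
  if S = {1, 2, 4} ∨ S = {1, 2, 5} then 0 else if S = {0, 4, 5} ∨ S = {3, 4, 5} then 1 else 2

set_option maxRecDepth 8192 in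
/-- **MJ is sharp**: the block configuration satisfies every hypothesis of `CrossMeetJoin` and attains equality
`#P = #(crossColMeets P c ∪ crossColCoJoins F P c)` (both sides equal 6). [this work] -/
theorem crossMeetJoin_sharp :
    (∀ S ∈ mjSharpP, S ⊆ (univ : Finset (Fin 6))) ∧
    (∀ S ∈ mjSharpP, ∀ T ∈ mjSharpP, mjSharpCol S ≠ mjSharpCol T → ¬ S ⊆ T) ∧
    (∀ S ∈ mjSharpP, ∀ T ∈ mjSharpP, (S ∩ T).Nonempty ∧ S ∪ T ≠ univ) ∧
    (∀ i : Fin 3, 2 ≤ #(mjSharpP.filter fun S => mjSharpCol S = i)) ∧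
    #mjSharpP = #(crossColMeets mjSharpP mjSharpCol ∪ crossColCoJoins univ mjSharpP mjSharpCol) := by
  refine ⟨fun S _ => subset_univ S, ?_, ?_, ?_, ?_⟩
  · decide
  · decide
  · decide
  · decide

end Summit.CriticalPhenomena.PercolationContinuityZ3.Theorems.SahiColouredDaykin
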